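import Summits.HodgeConjecture.HodgeConjecture.Theorems.SixfoldTableXCensusWeilSquareProductRowDomain
import Literature.AlgebraicGeometry.HodgeTheory.UnitaryTwoOneTimesCMCurveCubeCodimTwo
import Literature.AlgebraicGeometry.HodgeTheory.NoTypeIVTimesCMGrouping
import HarnessLib

/-!
# TABLE X (dimension 6) — row 21 `g6.E3xY3.(2,1)` (`X ∼ E_k³ × Y₃`, `Y₃` of type `(2,1)` with `End⁰(Y₃) = ℚ(√-d)`, `E` a CM
# elliptic curve): the census node X2 (codimension two) DISCHARGED IN THE KERNEL on the whole isogeny class, NO binder —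
# cell `pub-hodgeav-hg6`, req-37 (A) Q2b; census programme γ2, brick γ2-C, eng-2 g6 (lead g3 2026-08-29T01:57:40Z)

HONEST FRAMING. HC, `HC_AV` (stmt-1333), `HC_CM` (stmt-3052) and the rung H2 are NOT proved and do not occur here. The
census nodes `TableX.SixfoldCodimTwoCensus` (X2) / `TableX.SixfoldCodimThreeCensus` (X1) of `SixfoldTableXCover` are OURS
(`@[conjecture]`), never asserted — they quantify over ALL off-residue sixfolds; here X2 is DISCHARGED on one isogeny class
per hypothesis set, and X1 (codimension three) at this row is NOT touched (brick γ2-D). KERNEL ONLY: theorems over existing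
declarations; no definition, no `sorry`, no named fact, no displayed hypothesis; typed ≠ proved.

WHY THIS MODULE (census-node self-audit, axis A7 «a row VERIFIED in the kernel, not by dossier», continued). Row 21 was on
the theorem-less floor with only named-fact routes (FF26 Thm. 1.2 through the factor `(Y₃ × E)³`; Abdulali Thm. 14 for
`k ∈ {ℚ(i), ℚ(√-3)}`, `SixfoldTableXRow21OfAbdulali`). The tree's programme R41 (`UnitaryTwoOneTimesCMCurveSquareCodimTwo`:
Moonen–Zarhin's fivefold case (e), `T × E²`) is general in the second factor, and bricks γ2-A/B
(`HodgeCommutantAbelianOfProducts`, `UnitaryTwoOneTimesCMCurveCubeCodimTwo`) carried it to the SIXFOLD `T × E³`: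
`B²(T × E³) ⊆ D² + Σ_{a=1}^{3} α_a^* B²(T × E)` UNCONDITIONALLY (atlas «S-W4 for B²: pull-backs of `W_k(E_k × Y₃)`»,
TABLE-X-g6-v0 §1 row 21 — without naming the Weil classes). THIS FILE reads that in census currency:
* §1 `not_residueClass_of_isIsogenous_prod_prod_prod` — `A ∼ Y × ((C₁ × C₂) × C₃)` with `Y` simple non-CM (`dim Y ≠ 4 ∨
  dim_ℚ End⁰(Y) ≠ 4`) and three simple factors of positive dimension `< 4` is OFF `𝒞 = CM ∪ K3P` (L18b's two-factor lemma with
  one more level of `isSimpleIsogenyFactor_prod_iff`).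
* §2 `codimTwoCensusAt_unitaryTwoOne_prod_cmCurveCube` — X2 AT `Y × ((E × E) × E)` itself (γ2-B; the three pull-backs come from
  the FOURFOLD quotients `Y × E`, `dim 4 < 6`).
* §3 **`census_row21_codimTwo`** — TABLE X ROW 21, ALL MEMBERS, CODIMENSION TWO: for `Y` a complex abelian threefold with
  `dim_ℚ End⁰(Y) = 2`, `φ ≫ φ = -d` of multiplicity `1` at `± i√d`, `E` an elliptic curve with `χ ≫ χ = -d'` (ANY `d, d' > 0`:
  the resonant row-21 members `ℚ(χ) = ℚ(φ)` AND the non-interacting row-28 members alike) and every `A ∼ Y × ((E × E) × E)`: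
  `dim A = 6 ∧ ¬ 𝒞 A` (domain) AND X2-at-`A` (L7b transport `codimTwoCensusAt_iff_of_isIsogenous`); `census_row21_codimTwo'` for
  the order `A ∼ E³ × Y` (`E.powSucc 2 × Y`).

READING (honest scope). X2 at row 21 is now a kernel theorem for EVERY member; X1 (codimension three) at row 21 is OPEN in the
kernel (it needs the all-`W`/all-`W̄` sharpening of the invariance export: the one-per-pair words of `H³(T) ⊗ H³(E³)` must be
confined to `W_k(T) ⊗ H³(E³)` — brick γ2-D); HC for row 21 ⟸ Markman₄ (the cover's binder) or Abdulali/FF26 as recorded. No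
inhabitant is exhibited and none is invented. All declarations live in `TableX.ProductRows` (lead g2 DEDUP RULE). Nothing here
is a corollary of `HC_CM`; typed ≠ proved.
-/

set_option linter.dupNamespace false

noncomputable section

open CategoryTheory
open Literature.AlgebraicGeometry Literature.AlgebraicGeometry.Motives
open Literature.AlgebraicGeometry.Motives.AbelianVariety (IsIsogenous IsSimple)
open Literature.AlgebraicGeometry.HodgeTheory
open Literature.AlgebraicGeometry.Milne1999
open Literature.AlgebraicTopology.SingularHomology
open Literature.Barriers.HodgeConjecture
open Summit.HodgeConjecture.HodgeConjecture.Ring2.ClassTargets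
open Summit.HodgeConjecture.HodgeConjecture.Ring2.Motiv (ProdCMCell)
open Summit.HodgeConjecture.HodgeConjecture.Ring2.Atlas (IsQuarticFieldTypeIVFourfold)
open Summit.HodgeConjecture.HodgeConjecture.TableX.TypeIVRows (isSimple_and_not_isOfCMType_of_ribetTypeOne)

namespace Summit.HodgeConjecture.HodgeConjecture.TableX.ProductRows

/-! ## §1 Off the residue class: a simple non-CM factor and three small simple factors -/

/-- **`A ∼ Y × ((C₁ × C₂) × C₃)` is OFF the residue class `𝒞 = CM ∪ K3P`** when `Y` is SIMPLE, NOT of CM type, of positive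
dimension with `dim Y ≠ 4 ∨ dim_ℚ End⁰(Y) ≠ 4`, and `C₁`, `C₂`, `C₃` are SIMPLE of positive dimension `< 4` (row 21: `Y = Y₃(2,1)`,
`C_a = E_k`). CM type would pass to `Y`; a simple quartic-field fourfold factor would be isogenous to `Y` or to some `C_a`.
[cite: Milne1986AbelianVarieties, §12 p. 122] [cite: MumfordAV1970, §19 Cor. 1–2 (pp. 173–174)] -/
theorem not_residueClass_of_isIsogenous_prod_prod_prod {A Y C₁ C₂ C₃ : AbelianVariety ℂ} (hYs : Y.IsSimple)
    (hYcm : ¬ IsOfCMType Y) (h0Y : 0 < Y.dim) (hY : Y.dim ≠ 4 ∨ Module.finrank ℚ Y.endAlgebra ≠ 4)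
    (hC₁s : C₁.IsSimple) (h0C₁ : 0 < C₁.dim) (hC₁4 : C₁.dim < 4) (hC₂s : C₂.IsSimple) (h0C₂ : 0 < C₂.dim)
    (hC₂4 : C₂.dim < 4) (hC₃s : C₃.IsSimple) (h0C₃ : 0 < C₃.dim) (hC₃4 : C₃.dim < 4)
    (hA : IsIsogenous A (Y.prod ((C₁.prod C₂).prod C₃))) :
    ¬ (IsOfCMType A ∨ ProdCMCell IsQuarticFieldTypeIVFourfold (fun Z ↦ Z.dim = 2) A) := by
  refine fun h ↦ h.elim (ProductRows.not_isOfCMType_of_isIsogenous_prod_of_left hYcm hA) ?_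
  rintro ⟨Y', Z, hYZ, hY', -, -⟩
  obtain ⟨hY'4, hY's, -, hY'rk, -⟩ := hY'
  have hfacA : IsSimpleIsogenyFactor Y' A :=
    (isSimpleIsogenyFactor_congr_right hYZ).mpr ((isSimpleIsogenyFactor_self hY's (by omega)).prod_left)
  have hfac : IsSimpleIsogenyFactor Y' (Y.prod ((C₁.prod C₂).prod C₃)) := (isSimpleIsogenyFactor_congr_right hA).mp hfacA
  rcases isSimpleIsogenyFactor_prod_iff.mp hfac with h | h
  · have hiso : IsIsogenous Y' Y := (isSimpleIsogenyFactor_iff_isIsogenous_of_isSimple hYs h0Y).mp h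
    rcases hY with hY | hY
    · exact hY (hiso.dim_eq ▸ hY'4)
    · exact hY (hiso.finrank_endAlgebra_eq ▸ hY'rk)
  · rcases isSimpleIsogenyFactor_prod_iff.mp h with h₁₂ | h₃
    · rcases isSimpleIsogenyFactor_prod_iff.mp h₁₂ with h₁ | h₂
      · have hdim := ((isSimpleIsogenyFactor_iff_isIsogenous_of_isSimple hC₁s h0C₁).mp h₁).dim_eq
        omega
      · have hdim := ((isSimpleIsogenyFactor_iff_isIsogenous_of_isSimple hC₂s h0C₂).mp h₂).dim_eq
        omega
    · have hdim := ((isSimpleIsogenyFactor_iff_isIsogenous_of_isSimple hC₃s h0C₃).mp h₃).dim_eq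
      omega

/-! ## §2 X2 at `Y × ((E × E) × E)` itself -/

section Row21

variable {Y E : AbelianVariety ℂ}

/-- **X2 AT `Y × E³`** (`E³ = (E × E) × E`): every rational `(2,2)`-class on `Y × ((E × E) × E)` lies in `D²` plus the span of
pull-backs of rational Hodge `(2,2)`-classes from LOWER-dimensional abelian quotients — here the three fourfold quotients
`α_a = 𝟙 × q_a : Y × E³ → Y × E` (γ2-B `mem_divisorClassesSpan_sup_span_pullbacks_of_unitaryTwoOne_cmCurve_cube`; `dim (Y × E) = 4 < 6`).
HC ∕ HC_AV NOT proved; X2 stays `@[conjecture]` globally. [cite: MoonenZarhin1999LowDim, Thm. 0.2 (1), (2.8) and §5 (5.11)]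
[cite: vanGeemen1994HodgeAV, 4.9] -/
theorem codimTwoCensusAt_unitaryTwoOne_prod_cmCurveCube (hY3 : Y.dim = 3) (hY2 : Module.finrank ℚ Y.endAlgebra = 2)
    (φ : Y ⟶ Y) {d : ℕ} (hd : 0 < d) (hφ : φ ≫ φ = -(d • 𝟙 Y))
    (hm1 : eigenMultiplicity Y φ (Complex.I * (Real.sqrt d : ℂ)) = 1 ∨
      eigenMultiplicity Y φ (-(Complex.I * (Real.sqrt d : ℂ))) = 1)
    (hE1 : E.dim = 1) (χ : E ⟶ E) {d' : ℕ} (hd' : 0 < d') (hχ : χ ≫ χ = -(d' • 𝟙 E)) :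
    ∀ c : complexBetti (Y.prod ((E.prod E).prod E)).X (2 * 2), IsRationalClass c →
      IsOfHodgeType (Y.prod ((E.prod E).prod E)).dim (Y.prod ((E.prod E).prod E)).X (2 * 2) 2 2 c →
      c ∈ divisorClassesSpan (Y.prod ((E.prod E).prod E)).X (Y.prod ((E.prod E).prod E)).dim 2 ⊔
        Submodule.span ℂ {w' : complexBetti (Y.prod ((E.prod E).prod E)).X (2 * 2) |
          ∃ (C : AbelianVariety ℂ) (g : (Y.prod ((E.prod E).prod E)).X ⟶ C.X) (w : complexBetti C.X (2 * 2)),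
            C.dim < (Y.prod ((E.prod E).prod E)).dim ∧ IsRationalClass w ∧ IsOfHodgeType C.dim C.X (2 * 2) 2 2 w ∧
            w' = complexBetti.map g (2 * 2) w} := by
  intro c hcQ hc
  have hdim6 : (Y.prod ((E.prod E).prod E)).dim = 6 := by
    rw [Motives.AbelianVariety.dim_prod, Motives.AbelianVariety.dim_prod, Motives.AbelianVariety.dim_prod, hY3, hE1]
  have hdim4 : (Y.prod E).dim = 4 := by rw [Motives.AbelianVariety.dim_prod, hY3, hE1]
  have h := mem_divisorClassesSpan_sup_span_pullbacks_of_unitaryTwoOne_cmCurve_cube hY3 hY2 φ hd hφ hm1 hE1 χ hd' hχ hcQ hc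
  obtain ⟨x, hx, y, hy, hxy⟩ := Submodule.mem_sup.mp h
  rw [← hxy]
  refine Submodule.add_mem_sup hx (Submodule.span_mono ?_ hy)
  rintro w' ⟨q, w, -, hwQ, hwH, rfl⟩
  exact ⟨Y.prod E, (Motives.AbelianVariety.prodMap (𝟙 Y) q).hom.hom.hom, w, by rw [hdim4, hdim6]; norm_num, hwQ, hwH, rfl⟩

/-! ## §3 TABLE X row 21 `g6.E3xY3.(2,1)`, ALL MEMBERS, codimension two: kernel verdict with domain membership -/

/-- **TABLE X ROW 21 `g6.E3xY3.(2,1)`, ALL MEMBERS — the census node X2 (codimension two) in the KERNEL on the whole isogeny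
class, with domain membership, NO displayed hypothesis.** For `Y` a complex abelian threefold with `dim_ℚ End⁰(Y) = 2`,
`φ ≫ φ = -d` (`d > 0`) of multiplicity `1` at `i√d` or at `-i√d` (so `Y` is simple of type IV(1,1), signature `(2,1)`, not of CM
type), `E` an elliptic curve with complex multiplication `χ ≫ χ = -d'` (`d' > 0`; the row-21 members have `ℚ(χ) = ℚ(φ)`, but NO
relation between `d` and `d'` is needed), and every `A` isogenous to `Y × ((E × E) × E)`: `dim A = 6` and `A` is OFF the residue
class `𝒞` (§1), AND every rational `(2,2)`-class on `A` lies in `D²(A)` plus pull-backs of rational Hodge classes from abelian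
quotients of smaller dimension (§2 transported by L7b `codimTwoCensusAt_iff_of_isIsogenous`). X1 at row 21 is NOT asserted.
HC ∕ HC_AV NOT proved; X2 stays `@[conjecture]` globally. [cite: MoonenZarhin1999LowDim, Thm. 0.2 (1), (2.8), §5 (5.3), (5.11)]
[cite: vanGeemen1994HodgeAV, Lemma 3.7 and 4.9] [cite: MumfordAV1970, §19 Cor. 1–2 (pp. 173–174)] -/
theorem census_row21_codimTwo {A : AbelianVariety ℂ} (hY3 : Y.dim = 3) (hY2 : Module.finrank ℚ Y.endAlgebra = 2)
    (φ : Y ⟶ Y) {d : ℕ} (hd : 0 < d) (hφ : φ ≫ φ = -(d • 𝟙 Y))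
    (hm1 : eigenMultiplicity Y φ (Complex.I * (Real.sqrt d : ℂ)) = 1 ∨
      eigenMultiplicity Y φ (-(Complex.I * (Real.sqrt d : ℂ))) = 1)
    (hE1 : E.dim = 1) (χ : E ⟶ E) {d' : ℕ} (hd' : 0 < d') (hχ : χ ≫ χ = -(d' • 𝟙 E))
    (hA : IsIsogenous A (Y.prod ((E.prod E).prod E))) :
    (A.dim = 6 ∧ ¬ (IsOfCMType A ∨ ProdCMCell IsQuarticFieldTypeIVFourfold (fun Z ↦ Z.dim = 2) A)) ∧
    (∀ c : complexBetti A.X (2 * 2), IsRationalClass c → IsOfHodgeType A.dim A.X (2 * 2) 2 2 c →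
      c ∈ divisorClassesSpan A.X A.dim 2 ⊔ Submodule.span ℂ {w' : complexBetti A.X (2 * 2) |
        ∃ (C : AbelianVariety ℂ) (g : A.X ⟶ C.X) (w : complexBetti C.X (2 * 2)), C.dim < A.dim ∧
          IsRationalClass w ∧ IsOfHodgeType C.dim C.X (2 * 2) 2 2 w ∧ w' = complexBetti.map g (2 * 2) w}) := by
  have hdim6 : (Y.prod ((E.prod E).prod E)).dim = 6 := by
    rw [Motives.AbelianVariety.dim_prod, Motives.AbelianVariety.dim_prod, Motives.AbelianVariety.dim_prod, hY3, hE1]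
  obtain ⟨hYs, hYcm⟩ := isSimple_and_not_isOfCMType_of_ribetTypeOne φ hd hφ hY2 (by omega)
  have hEs : E.IsSimple := Motives.AbelianVariety.isSimple_of_dim_le_one hE1.le
  refine ⟨⟨by rw [hA.dim_eq, hdim6], not_residueClass_of_isIsogenous_prod_prod_prod hYs hYcm (by omega) (Or.inl (by omega))
      hEs (by omega) (by omega) hEs (by omega) (by omega) hEs (by omega) (by omega) hA⟩, ?_⟩
  exact (codimTwoCensusAt_iff_of_isIsogenous hA).mpr
    (codimTwoCensusAt_unitaryTwoOne_prod_cmCurveCube hY3 hY2 φ hd hφ hm1 hE1 χ hd' hχ)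

/-- **Row 21 in the order `A ∼ E³ × Y`** (`E.powSucc 2 = (E × E) × E`; commutativity of `×` up to isogeny,
`isIsogenous_prod_comm`). HC ∕ HC_AV NOT proved. [cite: MoonenZarhin1999LowDim, Thm. 0.2 (1) and (2.8)]
[cite: Milne1986AbelianVarieties, §12 Prop. 12.1 and p. 122] -/
theorem census_row21_codimTwo' {A : AbelianVariety ℂ} (hY3 : Y.dim = 3) (hY2 : Module.finrank ℚ Y.endAlgebra = 2)
    (φ : Y ⟶ Y) {d : ℕ} (hd : 0 < d) (hφ : φ ≫ φ = -(d • 𝟙 Y))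
    (hm1 : eigenMultiplicity Y φ (Complex.I * (Real.sqrt d : ℂ)) = 1 ∨
      eigenMultiplicity Y φ (-(Complex.I * (Real.sqrt d : ℂ))) = 1)
    (hE1 : E.dim = 1) (χ : E ⟶ E) {d' : ℕ} (hd' : 0 < d') (hχ : χ ≫ χ = -(d' • 𝟙 E))
    (hA : IsIsogenous A ((E.powSucc 2).prod Y)) :
    (A.dim = 6 ∧ ¬ (IsOfCMType A ∨ ProdCMCell IsQuarticFieldTypeIVFourfold (fun Z ↦ Z.dim = 2) A)) ∧
    (∀ c : complexBetti A.X (2 * 2), IsRationalClass c → IsOfHodgeType A.dim A.X (2 * 2) 2 2 c →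
      c ∈ divisorClassesSpan A.X A.dim 2 ⊔ Submodule.span ℂ {w' : complexBetti A.X (2 * 2) |
        ∃ (C : AbelianVariety ℂ) (g : A.X ⟶ C.X) (w : complexBetti C.X (2 * 2)), C.dim < A.dim ∧
          IsRationalClass w ∧ IsOfHodgeType C.dim C.X (2 * 2) 2 2 w ∧ w' = complexBetti.map g (2 * 2) w}) :=
  census_row21_codimTwo hY3 hY2 φ hd hφ hm1 hE1 χ hd' hχ (hA.trans (isIsogenous_prod_comm (E.powSucc 2) Y))

end Row21

end Summit.HodgeConjecture.HodgeConjecture.TableX.ProductRows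

end
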